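import Mathlib
import Summits.Ventures.PercRepro.TriangleCapRegularCellFourteenBlocksA

/-!
# PercRepro — THE REGULAR CELL `t = 14 D`: THE BLOCKS, PART B (p3, gen 57)

The row-size lists realising the excess values (rows of `14`, `28` or `42` edges), part B.  Axioms: standard.
-/

namespace PercRepro

namespace TriangleCap

namespace C047

open Finset

/-- The blocks, range `87 ≤ e ≤ 141`. -/
def blockFourteenB (e : ℕ) : List ℕ :=
  if e = 87 then [2, 2, 2, 2, 1, 1, 1, 1, 1, 1]
  else if e = 88 then [2, 2, 2, 1, 1, 1, 1, 1, 1, 1, 1]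
  else if e = 89 then [2, 2, 1, 1, 1, 1, 1, 1, 1, 1, 1, 1]
  else if e = 90 then [2, 1, 1, 1, 1, 1, 1, 1, 1, 1, 1, 1, 1]
  else if e = 91 then [1, 1, 1, 1, 1, 1, 1, 1, 1, 1, 1, 1, 1, 1]
  else if e = 92 then [8, 8, 8, 4]
  else if e = 93 then [9, 8, 6, 5]
  else if e = 94 then [9, 7, 7, 5]
  else if e = 95 then [8, 8, 7, 5]
  else if e = 96 then [8, 8, 6, 6]
  else if e = 97 then [8, 7, 7, 6]
  else if e = 98 then [7, 7, 7, 7]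
  else if e = 99 then [8, 8, 7, 4, 1]
  else if e = 100 then [9, 7, 6, 5, 1]
  else if e = 101 then [8, 8, 6, 5, 1]
  else if e = 102 then [8, 7, 7, 5, 1]
  else if e = 103 then [8, 7, 6, 6, 1]
  else if e = 104 then [7, 7, 7, 6, 1]
  else if e = 105 then [8, 7, 7, 4, 2]
  else if e = 106 then [8, 7, 7, 3, 3]
  else if e = 107 then [8, 7, 6, 5, 2]
  else if e = 108 then [7, 7, 7, 5, 2]
  else if e = 109 then [7, 7, 6, 6, 2]
  else if e = 110 then [7, 7, 7, 4, 3]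
  else if e = 111 then [8, 6, 6, 5, 3]
  else if e = 112 then [7, 7, 6, 5, 3]
  else if e = 113 then [7, 6, 6, 6, 3]
  else if e = 114 then [7, 7, 5, 5, 4]
  else if e = 115 then [7, 6, 6, 5, 4]
  else if e = 116 then [6, 6, 6, 6, 4]
  else if e = 117 then [6, 6, 6, 5, 5]
  else if e = 118 then [7, 6, 6, 5, 3, 1]
  else if e = 119 then [6, 6, 6, 6, 3, 1]
  else if e = 120 then [6, 6, 6, 6, 2, 2]
  else if e = 121 then [6, 6, 6, 5, 4, 1]
  else if e = 122 then [6, 6, 5, 5, 5, 1]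
  else if e = 123 then [6, 6, 6, 5, 3, 2]
  else if e = 124 then [6, 6, 6, 4, 4, 2]
  else if e = 125 then [6, 6, 5, 5, 4, 2]
  else if e = 126 then [6, 5, 5, 5, 5, 2]
  else if e = 127 then [6, 6, 5, 4, 4, 3]
  else if e = 128 then [6, 5, 5, 5, 4, 3]
  else if e = 129 then [5, 5, 5, 5, 5, 3]
  else if e = 130 then [5, 5, 5, 5, 4, 4]
  else if e = 131 then [5, 5, 5, 5, 5, 2, 1]
  else if e = 132 then [6, 5, 5, 4, 4, 3, 1]
  else if e = 133 then [5, 5, 5, 5, 4, 3, 1]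
  else if e = 134 then [5, 5, 5, 4, 4, 4, 1]
  else if e = 135 then [5, 5, 5, 5, 3, 3, 2]
  else if e = 136 then [5, 5, 5, 4, 4, 3, 2]
  else if e = 137 then [5, 5, 4, 4, 4, 4, 2]
  else if e = 138 then [5, 5, 4, 4, 4, 3, 3]
  else if e = 139 then [5, 4, 4, 4, 4, 4, 3]
  else if e = 140 then [4, 4, 4, 4, 4, 4, 4]
  else [5, 4, 4, 4, 4, 4, 2, 1]


end C047

end TriangleCap

end PercRepro
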